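import Literature.NumberTheory.DiophantineGeometry.AbcShapeFourierBound
import Literature.NumberTheory.DiophantineGeometry.AbcShapeReductionCount
import Literature.NumberTheory.Sieve.DivisorBound
import HarnessLib

/-!
# The endgame: `B_d ≪ C₀^{(23λ+3)/40 + o(1)}` on admissible data (Bernert, §4)

From the geometry-of-numbers bound `B ≤ 2P/P₀ + 112·V₂·P/C₀` (`shapeCount_succ_le` read on
admissible data; `P = ∏ᵢ XᵢYᵢZᵢ`, `Pᵢ = XᵢYᵢZᵢ`, `V₂ = 2^{d(d+1)/2}`) and the Fourier bounds
`B ≤ 2 D^d P^{2/3} / P_j^{1/6}` for `j = 1, 2, 3` (`shapeCount_le_fourier`), together with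
`∏ᵢ Pᵢ^{i+1} ≤ (2C₀)³` and `Pᵢ ≥ 1`, we derive [Bernert2025, §4, proof of Thm. 1] directly
(without contradiction): either `B ≤ 224 V₂ P/C₀ ≪ C₀^{λ-1+3ε}`, or `P₀ ≤ 4P/B` and
`P_j ≤ (2D^dP^{2/3}/B)⁶`, whence `P⁵ ≤ (2C₀)³ P₀⁴P₁³P₂²P₃` gives
`B^{40} ≤ 2^{47} C₀³ D^{36d} P^{23}` (`endgame_bound`). With `P ≤ (2C₀)^{λ+3ε}` and the divisor
bound `D ≪ C₀^{η/d}` this is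

> `B_d(c; X, Y, Z) ≤ K · C₀^{(23λ+3)/40 + 3ε + η}` for all data admissible for `(λ, ε)`

(`AbcShapes.shapeCount_le_of_admissible`, `0 ≤ λ ≤ 2`). Combined with the reduction
`abcExponentCount_le_of_shapeCount_le` this proves Theorem 1.2 of [BernertEtAl2024]
(= [Bernert2025, Thm. 1]); the discharge `bernertEtAl2024_thm_1_2_holds` of that named fact is in
`AbcExceptionalSetBoundsProofs`. Theorem 1.3 (exponent `0.6` for `λ < 1`, v2 of the source) is NOT
proved here.

## References

* [Bernert2025] C. Bernert, *The exceptional set in the abc conjecture*, arXiv:2506.13364 (2025),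
  §4 (proof of Theorem 1).
* [BernertEtAl2024] C. Bernert, T. Browning, J. D. Lichtman, J. Teräväinen, *Bounds on the
  exceptional set in the abc conjecture*, arXiv:2410.12234, Theorem 1.2 (v2), §5.
-/

noncomputable section

open Finset

namespace Literature.NumberTheory.DiophantineGeometry

namespace AbcShapes

/-! ### The arithmetic of the endgame -/

/-- **The endgame inequality** [Bernert2025, §4]: from `B ≤ 2P/P₀ + 112VP/C₀`,
`B ≤ 2DP^{2/3}/P_j^{1/6}` (`j = 1, 2, 3`) and `P⁵ ≤ (2C₀)³ P₀⁴P₁³P₂²P₃`, either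
`B ≤ 224 V P / C₀` or `B^{40} ≤ 2^{47} C₀³ D^{36} P^{23}`. [cite: Bernert2025, Theorem 1] -/
theorem endgame_bound {B P P₀ P₁ P₂ P₃ C₀ V D : ℝ} (hB : 0 < B) (hP : 0 < P) (hP₀ : 0 < P₀)
    (hP₁ : 0 < P₁) (hP₂ : 0 < P₂) (hP₃ : 0 < P₃) (hC₀ : 0 < C₀) (hD : 0 ≤ D)
    (hG : B ≤ 2 * P / P₀ + 112 * V * P / C₀)
    (hF₁ : B ≤ 2 * D * P ^ (2 / 3 : ℝ) / P₁ ^ (1 / 6 : ℝ))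
    (hF₂ : B ≤ 2 * D * P ^ (2 / 3 : ℝ) / P₂ ^ (1 / 6 : ℝ))
    (hF₃ : B ≤ 2 * D * P ^ (2 / 3 : ℝ) / P₃ ^ (1 / 6 : ℝ))
    (hprod : P ^ (5 : ℕ) ≤ (2 * C₀) ^ (3 : ℕ) * (P₀ ^ (4 : ℕ) * P₁ ^ (3 : ℕ) * P₂ ^ (2 : ℕ) * P₃)) :
    B ≤ 224 * V * P / C₀ ∨
      B ^ (40 : ℕ) ≤ 2 ^ (47 : ℕ) * C₀ ^ (3 : ℕ) * D ^ (36 : ℕ) * P ^ (23 : ℕ) := by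
  by_cases hcase : 2 * P / P₀ ≤ 112 * V * P / C₀
  · left
    have : 224 * V * P / C₀ = 2 * (112 * V * P / C₀) := by ring
    linarith
  · right
    push Not at hcase
    have hB4 : B ≤ 4 * P / P₀ := by
      have : 4 * P / P₀ = 2 * (2 * P / P₀) := by ring
      linarith
    have hP₀le : P₀ ≤ 4 * P / B := by
      rw [le_div_iff₀ hB]
      rw [le_div_iff₀ hP₀] at hB4
      linarith
    -- the Fourier bounds give `P_j ≤ Q⁶`
    set Q : ℝ := 2 * D * P ^ (2 / 3 : ℝ) / B with hQ
    have hQ0 : 0 ≤ Q := by positivity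
    have hF : ∀ {Pj : ℝ}, 0 < Pj → B ≤ 2 * D * P ^ (2 / 3 : ℝ) / Pj ^ (1 / 6 : ℝ) →
        Pj ≤ Q ^ (6 : ℕ) := by
      intro Pj hPj hFj
      have h6 : 0 < Pj ^ (1 / 6 : ℝ) := Real.rpow_pos_of_pos hPj _
      have h1 : Pj ^ (1 / 6 : ℝ) ≤ Q := by
        rw [hQ, le_div_iff₀ hB]
        rw [le_div_iff₀ h6] at hFj
        linarith
      calc Pj = (Pj ^ (1 / 6 : ℝ)) ^ (6 : ℕ) := by
            rw [← Real.rpow_mul_natCast hPj.le]; norm_num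
        _ ≤ Q ^ (6 : ℕ) := pow_le_pow_left₀ h6.le h1 6
    have h1 := hF hP₁ hF₁
    have h2 := hF hP₂ hF₂
    have h3 := hF hP₃ hF₃
    have hprod2 : P₀ ^ (4 : ℕ) * P₁ ^ (3 : ℕ) * P₂ ^ (2 : ℕ) * P₃ ≤
        (4 * P / B) ^ (4 : ℕ) * Q ^ (36 : ℕ) := by
      calc P₀ ^ (4 : ℕ) * P₁ ^ (3 : ℕ) * P₂ ^ (2 : ℕ) * P₃
          ≤ (4 * P / B) ^ (4 : ℕ) * (Q ^ (6 : ℕ)) ^ (3 : ℕ) * (Q ^ (6 : ℕ)) ^ (2 : ℕ) * Q ^ (6 : ℕ) := by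
            gcongr
        _ = (4 * P / B) ^ (4 : ℕ) * Q ^ (36 : ℕ) := by ring
    have hQ36 : Q ^ (36 : ℕ) = 2 ^ (36 : ℕ) * D ^ (36 : ℕ) * P ^ (24 : ℕ) / B ^ (36 : ℕ) := by
      rw [hQ, div_pow, mul_pow, mul_pow, ← Real.rpow_mul_natCast hP.le]
      norm_num
    have h4 : P ^ (5 : ℕ) ≤ (2 * C₀) ^ (3 : ℕ) * ((4 * P / B) ^ (4 : ℕ) * Q ^ (36 : ℕ)) :=
      hprod.trans (mul_le_mul_of_nonneg_left hprod2 (by positivity))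
    rw [hQ36] at h4
    have hB40 : 0 < B ^ (40 : ℕ) := by positivity
    have h5 : (2 * C₀) ^ (3 : ℕ) * ((4 * P / B) ^ (4 : ℕ) *
        (2 ^ (36 : ℕ) * D ^ (36 : ℕ) * P ^ (24 : ℕ) / B ^ (36 : ℕ))) =
        (2 ^ (47 : ℕ) * C₀ ^ (3 : ℕ) * D ^ (36 : ℕ) * P ^ (28 : ℕ)) / B ^ (40 : ℕ) := by
      field_simp
      ring
    rw [h5, le_div_iff₀ hB40] at h4
    have hP5 : 0 < P ^ (5 : ℕ) := by positivity
    have h6 : P ^ (5 : ℕ) * B ^ (40 : ℕ) ≤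
        P ^ (5 : ℕ) * (2 ^ (47 : ℕ) * C₀ ^ (3 : ℕ) * D ^ (36 : ℕ) * P ^ (23 : ℕ)) := by
      calc P ^ (5 : ℕ) * B ^ (40 : ℕ) ≤ 2 ^ (47 : ℕ) * C₀ ^ (3 : ℕ) * D ^ (36 : ℕ) * P ^ (28 : ℕ) := h4
        _ = P ^ (5 : ℕ) * (2 ^ (47 : ℕ) * C₀ ^ (3 : ℕ) * D ^ (36 : ℕ) * P ^ (23 : ℕ)) := by ring
    exact le_of_mul_le_mul_left h6 hP5

/-- `∏ᵢ pᵢ⁵ ≤ (∏ᵢ pᵢ^{i+1}) · p₀⁴ p₁³ p₂² p₃` for reals `pᵢ ≥ 1` indexed by `Fin (e + 4)`.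
[folklore] -/
theorem prod_pow_five_le {e : ℕ} (p : Fin (e + 4) → ℝ) (hp : ∀ i, 1 ≤ p i) :
    (∏ i, p i) ^ (5 : ℕ) ≤
      (∏ i, p i ^ ((i : ℕ) + 1)) * (p 0 ^ (4 : ℕ) * p 1 ^ (3 : ℕ) * p 2 ^ (2 : ℕ) * p 3) := by
  have h1 : (∏ i, p i) ^ (5 : ℕ) ≤ ∏ i, (p i ^ ((i : ℕ) + 1) * p i ^ (4 - (i : ℕ))) := by
    rw [← prod_pow]
    refine prod_le_prod (fun i _ => by have := hp i; positivity) fun i _ => ?_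
    rw [← pow_add]
    exact pow_le_pow_right₀ (hp i) (by omega)
  have h2 : ∏ i, (p i ^ ((i : ℕ) + 1) * p i ^ (4 - (i : ℕ))) =
      (∏ i, p i ^ ((i : ℕ) + 1)) * ∏ i, p i ^ (4 - (i : ℕ)) := prod_mul_distrib
  have h3 : ∏ i : Fin (e + 4), p i ^ (4 - (i : ℕ)) = p 0 ^ (4 : ℕ) * p 1 ^ (3 : ℕ) * p 2 ^ (2 : ℕ) * p 3 := by
    rw [Fin.prod_univ_succ, Fin.prod_univ_succ, Fin.prod_univ_succ, Fin.prod_univ_succ]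
    have h4 : ∏ i : Fin e, p (i.succ.succ.succ.succ) ^ (4 - ((i.succ.succ.succ.succ : Fin (e + 4)) : ℕ)) = 1 := by
      refine prod_eq_one fun i _ => ?_
      simp only [Fin.val_succ]
      rw [show 4 - ((i : ℕ) + 1 + 1 + 1 + 1) = 0 by omega, pow_zero]
    rw [h4]
    simp only [Fin.val_zero, Fin.val_succ, Fin.succ_zero_eq_one, mul_one]
    norm_num
    rw [show (Fin.succ 2 : Fin (e + 4)) = 3 from rfl]; ring
  rw [h2, h3] at h1
  exact h1

/-! ### The bound on admissible data -/

set_option maxHeartbeats 1600000 in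
-- one long (but elementary) bookkeeping proof: allow 8× the default heartbeat budget
/-- **`B_d ≪ C₀^{(23λ+3)/40 + 3ε + η}` on admissible data** [Bernert2025, §4]: for
`0 < ε < 1/2`, `λ ≤ 2`, `0 < η` and dimension `d = e + 4`, there is `K ≥ 0` such that
`B_d(c; X, Y, Z) ≤ K C₀^{(23λ+3)/40 + 3ε + η}` for all `(C₀; c; X, Y, Z)` admissible for
`(λ, ε)` (`AbcShapes.Admissible`). [cite: Bernert2025, Theorem 1] -/
theorem shapeCount_le_of_admissible (e : ℕ) {ε : ℝ} (hε : 0 < ε) (hε2 : ε < 1 / 2) {l : ℝ}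
    (hl2 : l ≤ 2) {η : ℝ} (hη : 0 < η) :
    ∃ K : ℝ, 0 ≤ K ∧ ∀ (C₀ c₁ c₂ c₃ : ℕ) (X Y Z : Fin (e + 4) → ℕ),
      Admissible l ε C₀ c₁ c₂ c₃ X Y Z →
        (shapeCount c₁ c₂ c₃ X Y Z : ℝ) ≤ K * (C₀ : ℝ) ^ ((23 * l + 3) / 40 + 3 * ε + η) := by
  set d : ℕ := e + 4 with hd
  -- the constant `V₂ = ∏ 2^{i+1}`
  set V2 : ℕ := shapeVal (fun _ : Fin (e + 4) => 2) with hV2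
  have hV2pos : 0 < V2 := shapeVal_pos fun _ => two_pos
  have hV2one : (1 : ℝ) ≤ V2 := by exact_mod_cast hV2pos
  -- the divisor bound with exponent `η / d`
  have hηd : 0 < η / d := by positivity
  obtain ⟨Cτ, hCτ1, hCτ⟩ := Literature.NumberTheory.Sieve.exists_card_divisors_le_mul_rpow hηd
  set θ : ℝ := (23 * l + 3) / 40 + 3 * ε + η with hθ
  -- the constant
  set K : ℝ := 224 * V2 * 16 + 32 * Cτ ^ d * (2 * V2 : ℝ) ^ η with hK
  have hK0 : 0 ≤ K := by positivity
  refine ⟨K, hK0, fun C₀ c₁ c₂ c₃ X Y Z hA => ?_⟩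
  obtain ⟨hC₀1, hc₁, hc₂, hc₃, -, -, -, hXp, hYp, hZp, hPle, hvX, hvY, hvZ, hC₀le⟩ := hA
  set B : ℕ := shapeCount c₁ c₂ c₃ X Y Z with hB
  have hC₀ : (0 : ℝ) < C₀ := by exact_mod_cast hC₀1
  have hC₀1' : (1 : ℝ) ≤ C₀ := by exact_mod_cast hC₀1
  have h2C₀ : (1 : ℝ) ≤ 2 * C₀ := by linarith
  have hKC : 0 ≤ K * (C₀ : ℝ) ^ θ := by positivity
  -- trivial case `B = 0`
  rcases Nat.eq_zero_or_pos B with hB0 | hBpos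
  · rw [hB0, Nat.cast_zero]; exact hKC
  have hBpos' : (0 : ℝ) < B := by exact_mod_cast hBpos
  -- the real quantities
  set p : Fin (e + 4) → ℝ := fun i => ((X i * Y i * Z i : ℕ) : ℝ) with hp
  have hp1 : ∀ i, 1 ≤ p i := fun i => by
    simp only [hp]; exact_mod_cast Nat.mul_pos (Nat.mul_pos (hXp i) (hYp i)) (hZp i)
  have hp0 : ∀ i, 0 < p i := fun i => lt_of_lt_of_le one_pos (hp1 i)
  set P : ℝ := ∏ i, p i with hP
  have hP1 : 1 ≤ P := by
    rw [hP, ← prod_const_one]; exact prod_le_prod (fun _ _ => zero_le_one) fun i _ => hp1 i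
  have hP0 : 0 < P := lt_of_lt_of_le one_pos hP1
  have hPeq : P = ∏ i, ((X i : ℝ) * Y i * Z i) := by
    simp only [hP, hp]; push_cast; rfl
  have hPle' : P ≤ (2 * C₀ : ℝ) ^ (l + 3 * ε) := by rw [hPeq]; exact hPle
  /- the geometry-of-numbers bound `B ≤ 2P/p₀ + 112 V₂ P / C₀` -/
  have hG : (B : ℝ) ≤ 2 * P / p 0 + 112 * V2 * P / C₀ := by
    have h1 := shapeCount_succ_le (c₁ := c₁) (c₂ := c₂) hc₃ X Y Z
    set R : ℝ := ∏ i : Fin (e + 3), ((X i.succ : ℝ) * Y i.succ * Z i.succ) with hR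
    have hPR : P = p 0 * R := by
      rw [hP, Fin.prod_univ_succ, hR]
      simp only [hp]; push_cast; rfl
    have hR0 : 0 < R := by
      rw [hR]; exact prod_pos fun i _ => by
        have := hXp i.succ; have := hYp i.succ; have := hZp i.succ; positivity
    -- the denominator `c₃ ∏_{i≥1} Z_i^{i+1} = c₃ V(Z) / Z₀ ≥ C₀ / (V₂ Z₀)`
    have hden : (c₃ : ℝ) * ∏ i : Fin (e + 3), (Z i.succ : ℝ) ^ ((i : ℕ) + 2) =
        (c₃ * shapeVal Z : ℕ) / (Z 0 : ℝ) := by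
      have hZ0 : (Z 0 : ℝ) ≠ 0 := by exact_mod_cast (hZp 0).ne'
      rw [eq_div_iff hZ0, shapeVal_succ]
      push_cast
      simp only [shapeTailVal, Fin.tail]
      push_cast
      ring
    have hval : (C₀ : ℝ) ≤ V2 * (c₃ * shapeVal Z : ℕ) := by exact_mod_cast hC₀le
    have hcV : (0 : ℝ) < (c₃ * shapeVal Z : ℕ) := by
      exact_mod_cast Nat.mul_pos hc₃ (shapeVal_pos hZp)
    have hfrac : (X 0 : ℝ) * Y 0 / ((c₃ : ℝ) * ∏ i : Fin (e + 3), (Z i.succ : ℝ) ^ ((i : ℕ) + 2)) ≤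
        p 0 * V2 / C₀ := by
      rw [hden, div_div_eq_mul_div]
      have : (X 0 : ℝ) * Y 0 * Z 0 = p 0 := by simp only [hp]; push_cast; ring
      rw [this, div_le_div_iff₀ hcV hC₀]
      calc p 0 * (C₀ : ℝ) ≤ p 0 * (V2 * (c₃ * shapeVal Z : ℕ)) :=
            mul_le_mul_of_nonneg_left hval (hp0 0).le
        _ = p 0 * V2 * (c₃ * shapeVal Z : ℕ) := by ring
    have hp00 : p 0 ≠ 0 := (hp0 0).ne'
    calc (B : ℝ) ≤ R * (2 + 112 * (X 0 : ℝ) * Y 0 /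
          (c₃ * ∏ i : Fin (e + 3), (Z i.succ : ℝ) ^ ((i : ℕ) + 2))) := h1
      _ = R * (2 + 112 * ((X 0 : ℝ) * Y 0 /
          (c₃ * ∏ i : Fin (e + 3), (Z i.succ : ℝ) ^ ((i : ℕ) + 2)))) := by ring
      _ ≤ R * (2 + 112 * (p 0 * V2 / C₀)) := by gcongr
      _ = 2 * P / p 0 + 112 * V2 * P / C₀ := by
          rw [hPR]; field_simp
  /- the Fourier bounds at `j = 1, 2, 3` -/
  set T : ℕ := V2 * (2 * C₀) with hT
  have hT1 : 1 ≤ T := Nat.mul_pos hV2pos (by omega)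
  have hTval : ∀ {c : ℕ} {W : Fin (e + 4) → ℕ}, c * shapeVal W ≤ 2 * C₀ →
      c * shapeVal (fun i => 2 * W i) ≤ T := by
    intro c W hW
    calc c * shapeVal (fun i => 2 * W i) = V2 * (c * shapeVal W) := by
          rw [show (fun i => 2 * W i) = fun i => (fun _ : Fin (e + 4) => 2) i * W i from rfl,
            shapeVal_mul]; ring
      _ ≤ V2 * (2 * C₀) := Nat.mul_le_mul_left _ hW
  set D : ℕ := ⌊Cτ * (T : ℝ) ^ (η / d)⌋₊ with hD
  have hDτ : ∀ m : ℕ, m ≠ 0 → m ≤ T → m.divisors.card ≤ D := by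
    intro m hm hmT
    refine Nat.le_floor ((hCτ m hm).trans ?_)
    exact mul_le_mul_of_nonneg_left (Real.rpow_le_rpow (Nat.cast_nonneg _)
      (by exact_mod_cast hmT) hηd.le) (by linarith)
  have hD1 : 1 ≤ D := by
    have := hDτ 1 one_ne_zero hT1
    simpa using this
  have hDreal : (D : ℝ) ≤ Cτ * (T : ℝ) ^ (η / d) := Nat.floor_le (by positivity)
  have hN : (((dyadicBox X).card * (dyadicBox Y).card * (dyadicBox Z).card : ℕ) : ℝ) = P := by
    rw [card_dyadicBox, card_dyadicBox, card_dyadicBox, hP]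
    simp only [hp]; push_cast
    rw [← prod_mul_distrib, ← prod_mul_distrib]
  have hFj : ∀ (j : Fin (e + 4)), 1 ≤ (j : ℕ) →
      (B : ℝ) ≤ 2 * ((D : ℝ) ^ d) * P ^ (2 / 3 : ℝ) / (p j) ^ (1 / 6 : ℝ) := by
    intro j hj
    have h := shapeCount_le_fourier hc₁ hc₂ hc₃ X Y Z hXp hYp hZp j hj (hTval hvX) (hTval hvY)
      (hTval hvZ) hDτ
    rw [hN] at h
    simpa only [hp, hd] using h
  have hF₁ := hFj ⟨1, by omega⟩ le_rfl
  have hF₂ := hFj ⟨2, by omega⟩ (by norm_num)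
  have hF₃ := hFj ⟨3, by omega⟩ (by norm_num)
  /- `P⁵ ≤ (2C₀)³ p₀⁴p₁³p₂²p₃` -/
  have hprod : P ^ (5 : ℕ) ≤ (2 * C₀ : ℝ) ^ (3 : ℕ) *
      (p 0 ^ (4 : ℕ) * p 1 ^ (3 : ℕ) * p 2 ^ (2 : ℕ) * p 3) := by
    refine (prod_pow_five_le p hp1).trans (mul_le_mul_of_nonneg_right ?_ (by
      have := hp0 0; have := hp0 1; have := hp0 2; have := hp0 3; positivity))
    -- `∏ pᵢ^{i+1} = V(X) V(Y) V(Z) ≤ (2C₀)³`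
    have h1 : (∏ i, p i ^ ((i : ℕ) + 1)) = ((shapeVal X * shapeVal Y * shapeVal Z : ℕ) : ℝ) := by
      simp only [hp, shapeVal]; push_cast
      rw [← prod_mul_distrib, ← prod_mul_distrib]
      exact prod_congr rfl fun i _ => by ring
    rw [h1]
    have hx : shapeVal X ≤ 2 * C₀ := le_trans (Nat.le_mul_of_pos_left _ hc₁) hvX
    have hy : shapeVal Y ≤ 2 * C₀ := le_trans (Nat.le_mul_of_pos_left _ hc₂) hvY
    have hz : shapeVal Z ≤ 2 * C₀ := le_trans (Nat.le_mul_of_pos_left _ hc₃) hvZ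
    calc ((shapeVal X * shapeVal Y * shapeVal Z : ℕ) : ℝ) ≤ ((2 * C₀) * (2 * C₀) * (2 * C₀) : ℕ) := by
          exact_mod_cast Nat.mul_le_mul (Nat.mul_le_mul hx hy) hz
      _ = (2 * C₀ : ℝ) ^ (3 : ℕ) := by push_cast; ring
  /- apply the endgame inequality -/
  have hmain := endgame_bound hBpos' hP0 (hp0 0) (hp0 1) (hp0 2) (hp0 3) hC₀
    (by positivity) hG hF₁ hF₂ hF₃ hprod
  -- exponent bookkeeping
  have hpow2 : (2 : ℝ) ^ (l + 3 * ε) ≤ 16 := by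
    calc (2 : ℝ) ^ (l + 3 * ε) ≤ (2 : ℝ) ^ (4 : ℝ) :=
          Real.rpow_le_rpow_of_exponent_le one_le_two (by linarith)
      _ = 16 := by norm_num
  have hPle2 : P ≤ 16 * (C₀ : ℝ) ^ (l + 3 * ε) := by
    calc P ≤ (2 * C₀ : ℝ) ^ (l + 3 * ε) := hPle'
      _ = (2 : ℝ) ^ (l + 3 * ε) * (C₀ : ℝ) ^ (l + 3 * ε) := Real.mul_rpow zero_le_two hC₀.le
      _ ≤ 16 * (C₀ : ℝ) ^ (l + 3 * ε) := mul_le_mul_of_nonneg_right hpow2 (by positivity)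
  rcases hmain with hcase | hcase
  · -- `B ≤ 224 V₂ P / C₀ ≤ 224 V₂ · 16 · C₀^{λ+3ε-1} ≤ K C₀^θ`
    have hexp : (C₀ : ℝ) ^ (l + 3 * ε) / C₀ ≤ (C₀ : ℝ) ^ θ := by
      rw [div_le_iff₀ hC₀, ← Real.rpow_add_one hC₀.ne']
      exact Real.rpow_le_rpow_of_exponent_le hC₀1' (by rw [hθ]; linarith)
    calc (B : ℝ) ≤ 224 * V2 * P / C₀ := hcase
      _ ≤ 224 * V2 * (16 * (C₀ : ℝ) ^ (l + 3 * ε)) / C₀ := by gcongr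
      _ = 224 * V2 * 16 * ((C₀ : ℝ) ^ (l + 3 * ε) / C₀) := by ring
      _ ≤ 224 * V2 * 16 * (C₀ : ℝ) ^ θ := mul_le_mul_of_nonneg_left hexp (by positivity)
      _ ≤ K * (C₀ : ℝ) ^ θ := by
          refine mul_le_mul_of_nonneg_right ?_ (by positivity)
          rw [hK]; linarith [show (0 : ℝ) ≤ 32 * Cτ ^ d * (2 * V2 : ℝ) ^ η by positivity]
  · -- `B^{40} ≤ 2^{47} C₀³ (D^d)^{36} P^{23}`: take `40`-th roots factor by factor
    have hDd1 : (1 : ℝ) ≤ (D : ℝ) ^ d := one_le_pow₀ (by exact_mod_cast hD1)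
    have hDd : (D : ℝ) ^ d ≤ Cτ ^ d * (2 * V2 : ℝ) ^ η * (C₀ : ℝ) ^ η := by
      have hT' : (T : ℝ) = 2 * V2 * C₀ := by rw [hT]; push_cast; ring
      calc (D : ℝ) ^ d ≤ (Cτ * (T : ℝ) ^ (η / d)) ^ d := pow_le_pow_left₀ (Nat.cast_nonneg _) hDreal d
        _ = Cτ ^ d * (T : ℝ) ^ η := by
            rw [mul_pow, ← Real.rpow_mul_natCast (Nat.cast_nonneg _), div_mul_cancel₀ _ (by
              rw [hd]; positivity)]
        _ = Cτ ^ d * (2 * V2 : ℝ) ^ η * (C₀ : ℝ) ^ η := by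
            rw [hT', Real.mul_rpow (by positivity) hC₀.le]; ring
    -- `B ≤ (2^47)^{1/40} (C₀³)^{1/40} ((D^d)^36)^{1/40} (P^23)^{1/40}`
    have e2 : ((2 : ℝ) ^ (47 : ℕ)) ^ (((40 : ℕ) : ℝ)⁻¹) = (2 : ℝ) ^ (47 / 40 : ℝ) := by
      rw [← Real.rpow_natCast, ← Real.rpow_mul zero_le_two]; norm_num
    have eC : ((C₀ : ℝ) ^ (3 : ℕ)) ^ (((40 : ℕ) : ℝ)⁻¹) = (C₀ : ℝ) ^ (3 / 40 : ℝ) := by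
      rw [← Real.rpow_natCast, ← Real.rpow_mul hC₀.le]; norm_num
    have eD : (((D : ℝ) ^ d) ^ (36 : ℕ)) ^ (((40 : ℕ) : ℝ)⁻¹) = ((D : ℝ) ^ d) ^ (36 / 40 : ℝ) := by
      rw [← Real.rpow_natCast, ← Real.rpow_mul (by positivity)]; norm_num
    have eP : (P ^ (23 : ℕ)) ^ (((40 : ℕ) : ℝ)⁻¹) = P ^ (23 / 40 : ℝ) := by
      rw [← Real.rpow_natCast, ← Real.rpow_mul hP0.le]; norm_num
    have h40 : (B : ℝ) ≤ (2 : ℝ) ^ (47 / 40 : ℝ) * (C₀ : ℝ) ^ (3 / 40 : ℝ) *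
        ((D : ℝ) ^ d) ^ (36 / 40 : ℝ) * P ^ (23 / 40 : ℝ) := by
      have h1 : (B : ℝ) = (((B : ℝ)) ^ (40 : ℕ)) ^ (((40 : ℕ) : ℝ)⁻¹) :=
        (Real.pow_rpow_inv_natCast hBpos'.le (by norm_num)).symm
      rw [h1, ← e2, ← eC, ← eD, ← eP, ← Real.mul_rpow (by positivity) (by positivity),
        ← Real.mul_rpow (by positivity) (by positivity), ← Real.mul_rpow (by positivity) (by positivity)]
      exact Real.rpow_le_rpow (by positivity) hcase (by positivity)
    -- bound each factor
    have hf1 : (2 : ℝ) ^ (47 / 40 : ℝ) ≤ 4 := by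
      calc (2 : ℝ) ^ (47 / 40 : ℝ) ≤ (2 : ℝ) ^ (2 : ℝ) :=
            Real.rpow_le_rpow_of_exponent_le one_le_two (by norm_num)
        _ = 4 := by norm_num
    have hf3 : ((D : ℝ) ^ d) ^ (36 / 40 : ℝ) ≤ Cτ ^ d * (2 * V2 : ℝ) ^ η * (C₀ : ℝ) ^ η :=
      calc ((D : ℝ) ^ d) ^ (36 / 40 : ℝ) ≤ ((D : ℝ) ^ d) ^ (1 : ℝ) :=
            Real.rpow_le_rpow_of_exponent_le hDd1 (by norm_num)
        _ = (D : ℝ) ^ d := Real.rpow_one _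
        _ ≤ _ := hDd
    have hf4 : P ^ (23 / 40 : ℝ) ≤ 8 * (C₀ : ℝ) ^ (23 * (l + 3 * ε) / 40) := by
      calc P ^ (23 / 40 : ℝ) ≤ ((2 * C₀ : ℝ) ^ (l + 3 * ε)) ^ (23 / 40 : ℝ) :=
            Real.rpow_le_rpow hP0.le hPle' (by norm_num)
        _ = (2 : ℝ) ^ ((l + 3 * ε) * (23 / 40)) * (C₀ : ℝ) ^ (23 * (l + 3 * ε) / 40) := by
            rw [← Real.rpow_mul (by positivity), Real.mul_rpow zero_le_two hC₀.le]
            congr 1; congr 1; ring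
        _ ≤ 8 * (C₀ : ℝ) ^ (23 * (l + 3 * ε) / 40) := by
            refine mul_le_mul_of_nonneg_right ?_ (by positivity)
            calc (2 : ℝ) ^ ((l + 3 * ε) * (23 / 40)) ≤ (2 : ℝ) ^ (3 : ℝ) :=
                  Real.rpow_le_rpow_of_exponent_le one_le_two (by linarith)
              _ = 8 := by norm_num
    have hexp : (C₀ : ℝ) ^ (3 / 40 : ℝ) * (C₀ : ℝ) ^ η * (C₀ : ℝ) ^ (23 * (l + 3 * ε) / 40) ≤
        (C₀ : ℝ) ^ θ := by
      rw [← Real.rpow_add hC₀, ← Real.rpow_add hC₀]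
      exact Real.rpow_le_rpow_of_exponent_le hC₀1' (by rw [hθ]; linarith)
    calc (B : ℝ) ≤ (2 : ℝ) ^ (47 / 40 : ℝ) * (C₀ : ℝ) ^ (3 / 40 : ℝ) *
          ((D : ℝ) ^ d) ^ (36 / 40 : ℝ) * P ^ (23 / 40 : ℝ) := h40
      _ ≤ 4 * (C₀ : ℝ) ^ (3 / 40 : ℝ) * (Cτ ^ d * (2 * V2 : ℝ) ^ η * (C₀ : ℝ) ^ η) *
          (8 * (C₀ : ℝ) ^ (23 * (l + 3 * ε) / 40)) := by
          have h0a : (0 : ℝ) ≤ (C₀ : ℝ) ^ (3 / 40 : ℝ) := by positivity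
          have h0b : (0 : ℝ) ≤ P ^ (23 / 40 : ℝ) := by positivity
          have h0c : (0 : ℝ) ≤ ((D : ℝ) ^ d) ^ (36 / 40 : ℝ) := by positivity
          have h0d : (0 : ℝ) ≤ 4 * (C₀ : ℝ) ^ (3 / 40 : ℝ) * (Cτ ^ d * (2 * V2 : ℝ) ^ η * (C₀ : ℝ) ^ η) := by
            positivity
          refine mul_le_mul (mul_le_mul (mul_le_mul_of_nonneg_right hf1 h0a) hf3 h0c ?_) hf4 h0b h0d
          positivity
      _ = 32 * Cτ ^ d * (2 * V2 : ℝ) ^ η *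
          ((C₀ : ℝ) ^ (3 / 40 : ℝ) * (C₀ : ℝ) ^ η * (C₀ : ℝ) ^ (23 * (l + 3 * ε) / 40)) := by ring
      _ ≤ 32 * Cτ ^ d * (2 * V2 : ℝ) ^ η * (C₀ : ℝ) ^ θ :=
          mul_le_mul_of_nonneg_left hexp (by positivity)
      _ ≤ K * (C₀ : ℝ) ^ θ := by
          refine mul_le_mul_of_nonneg_right ?_ (by positivity)
          rw [hK]; linarith [show (0 : ℝ) ≤ 224 * V2 * 16 by positivity]

end AbcShapes

end Literature.NumberTheory.DiophantineGeometry
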